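import Summits.NavierStokesRegularity.NavierStokesRegularity.Theorems.OddMorawetzLocal.Negative.OddMorawetzLocalJetAlgebra
import Summits.NavierStokesRegularity.NavierStokesRegularity.Theorems.OddMorawetzDefs

/-!
# Crux `OddMorawetzLocal` (stmt-NavierStokesRegularity-1376) — refutation vocabulary VI: the exact evaluator

Definitions only. A kernel-computable evaluation of the Morawetz pairing `Q_p(v) = -∫ lin p (Jv)(J B(v,v))` of a cubic
jet polynomial `p` at an explicit polynomial-Gaussian field `v = pgv 1 P`, following the decomposition of the tree's
`pairing_value` (`OddMorawetzOddMorawetzLocalPairingValue.lean`):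
`Q_p(v) = -∫ ⟪B(v,v), G⟫`, `G = E_p e^{-2|x|²}` the Euler–Lagrange field of `p` along `v` (integration by parts), and
`∫ ⟪B(v,v), G⟫ = -½ [∫ ⟪W, G⟫ − (2π)⁻² (π/2)³ ∫ h_W h_G e^{-π²|ξ|²} |ξ|⁻² dξ]`, `W = 2(v·∇)v`, with `h_W`, `h_G` the even
Hermite symbols of `div W`, `div G`.
* `EPoly` — sparse polynomials in `x₀, x₁, x₂` with rational coefficients (lists of (coefficient, exponents)), their
  real evaluation `EPoly.eval`, their image `EPoly.toP3` in the tree's `P3 = MvPolynomial (Fin 3) ℝ`, ring operations,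
  the Gaussian-conjugated derivative `EPoly.dg k j` (`∂ⱼ − 2k xⱼ`, the tree's `dg` on lists), normal form, Hermite
  expansion by elimination from the top (`EPoly.hermExp`, fuelled, returns coefficients and remainder), Gaussian moments
  at rate 4 (`EPoly.locMoment`) and Riesz–Gaussian moments of a product of Hermite symbols (`EPoly.rieszPair`);
* the pipeline: jets `ejet`, the Euler–Lagrange field `eEP p P`, `eWP` (`W`), divergences `ediv`, the local product
  `eLoc`, the Hermite data `eHermW`/`eHermG`, and the one-pass result `evalRes = (success-and-parity flag, value)`
  (`Q_p(pgv 1 P) = value · π√π` when the flag holds is the soundness theorem, proved elsewhere; `Q_p` is additive in the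
  terms of `p`, so long polynomials are evaluated in chunks);
* the (noncomputable) conversions `toLW`, `toMloc`, `toMfour`, `toP3v` into the data format of `pairing_value`.
Plain `def`s; nothing restates a tree notion.
-/

set_option linter.dupNamespace false
set_option autoImplicit false

namespace Summit.NavierStokesRegularity.NavierStokesRegularity.Theorems.OddMorawetz

open MvPolynomial

/-- Sparse polynomials in three variables over `ℚ`: lists of (coefficient, exponents of `x₀, x₁, x₂`). -/
abbrev EPoly := List (ℚ × ℕ × ℕ × ℕ)

namespace EPoly

/-- Real value at a point of `ℝ³`. -/
noncomputable def eval (p : EPoly) (x : E3) : ℝ :=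
  (p.map fun t => (t.1 : ℝ) * (x 0 ^ t.2.1 * x 1 ^ t.2.2.1 * x 2 ^ t.2.2.2)).sum

/-- The polynomial of `P3 = MvPolynomial (Fin 3) ℝ` represented by the list. -/
noncomputable def toP3 (p : EPoly) : P3 :=
  (p.map fun t => C (t.1 : ℝ) * (X 0 ^ t.2.1 * X 1 ^ t.2.2.1 * X 2 ^ t.2.2.2)).sum

/-- Scalar multiple. -/
def smul (c : ℚ) (p : EPoly) : EPoly := p.map fun t => (c * t.1, t.2)

/-- Product (concatenation of all pairwise products). -/
def mul (p q : EPoly) : EPoly :=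
  p.flatMap fun s => q.map fun t => (s.1 * t.1, s.2.1 + t.2.1, s.2.2.1 + t.2.2.1, s.2.2.2 + t.2.2.2)

/-- Partial derivative `∂ⱼ` (a term without `xⱼ` gets coefficient `0`). -/
def pderiv (j : Fin 3) (p : EPoly) : EPoly :=
  p.map fun t =>
    if j = 0 then (t.1 * t.2.1, t.2.1 - 1, t.2.2.1, t.2.2.2)
    else if j = 1 then (t.1 * t.2.2.1, t.2.1, t.2.2.1 - 1, t.2.2.2)
    else (t.1 * t.2.2.2, t.2.1, t.2.2.1, t.2.2.2 - 1)

/-- Multiplication by the variable `xⱼ`. -/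
def mulX (j : Fin 3) (p : EPoly) : EPoly :=
  p.map fun t =>
    if j = 0 then (t.1, t.2.1 + 1, t.2.2.1, t.2.2.2)
    else if j = 1 then (t.1, t.2.1, t.2.2.1 + 1, t.2.2.2)
    else (t.1, t.2.1, t.2.2.1, t.2.2.2 + 1)

/-- The Gaussian-conjugated derivative `∂ⱼ (q e^{-k|x|²}) = (dg k j q) e^{-k|x|²}`: `dg k j q = ∂ⱼ q − 2k xⱼ q`
(the tree's `dg` on lists). -/
def dg (k : ℕ) (j : Fin 3) (p : EPoly) : EPoly := pderiv j p ++ smul (-(2 * (k : ℚ))) (mulX j p)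

/-- Insert a term into a list with pairwise distinct exponents, adding coefficients of equal exponents. -/
def insertTerm (c : ℚ) (e : ℕ × ℕ × ℕ) : EPoly → EPoly
  | [] => [(c, e)]
  | (c', e') :: p => if e' = e then (c' + c, e) :: p else (c', e') :: insertTerm c e p

/-- Collect equal exponents. -/
def collect (p : EPoly) : EPoly := p.foldr (fun t acc => insertTerm t.1 t.2 acc) []

/-- Normal form: collected, zero coefficients dropped (exponents pairwise distinct). -/
def norm (p : EPoly) : EPoly := (collect p).filter fun t => t.1 ≠ 0

/-- Iterated conjugated derivatives along a list of directions (outermost first) — the tree's `dgList` on lists —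
normalised after every step (the raw lists would double in length at each derivative). -/
def dgList (k : ℕ) (l : List (Fin 3)) (p : EPoly) : EPoly := l.foldr (fun j acc => norm (dg k j acc)) p

/-- Total degree of an exponent triple. -/
def tdeg (e : ℕ × ℕ × ℕ) : ℕ := e.1 + e.2.1 + e.2.2

/-- A term of maximal total degree (the first one among those), if any. -/
def maxMono : EPoly → Option (ℚ × ℕ × ℕ × ℕ)
  | [] => none
  | t :: p => match maxMono p with
    | none => some t
    | some s => if tdeg t.2 < tdeg s.2 then some s else some t

/-- The list of directions `[0,…,0,1,…,1,2,…,2]` with multiplicities `e`. -/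
def dirList (e : ℕ × ℕ × ℕ) : List (Fin 3) := List.replicate e.1 0 ++ (List.replicate e.2.1 1 ++ List.replicate e.2.2 2)

/-- The Hermite polynomial of the rate-2 Gaussian: `D^{e} e^{-2|x|²} = (he e) e^{-2|x|²}`. -/
def he (e : ℕ × ℕ × ℕ) : EPoly := dgList 2 (dirList e) [(1, 0, 0, 0)]

/-- Hermite expansion by elimination from the top: `q e^{-2|x|²} = Σ d_e D^e e^{-2|x|²} + (remainder) e^{-2|x|²}`.
Returns the coefficient list and the remainder (empty on success); fuelled. -/
def hermExp : ℕ → EPoly → List (ℚ × ℕ × ℕ × ℕ) × EPoly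
  | 0, q => ([], norm q)
  | fuel + 1, q =>
    match maxMono (norm q) with
    | none => ([], [])
    | some (c, e) =>
      let d := c / ((-4 : ℚ) ^ tdeg e)
      let r := hermExp fuel (norm q ++ smul (-d) (he e))
      ((d, e) :: r.1, r.2)

/-- All exponent triples are even. -/
def allEven (L : List (ℚ × ℕ × ℕ × ℕ)) : Bool :=
  L.all fun t => t.2.1 % 2 == 0 && t.2.2.1 % 2 == 0 && t.2.2.2 % 2 == 0

/-- `(2a − 1)!!` as a rational number. -/
def dfOdd (a : ℕ) : ℚ := ((2 * a - 1).doubleFactorial : ℚ)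

/-- The rate-4 Gaussian moment of an even polynomial divided by `π√π`:
`∫ x₀^{2a} x₁^{2b} x₂^{2c} e^{-4|x|²} dx = (2a−1)!!(2b−1)!!(2c−1)!! π√π /(8^{a+b+c}·8)` (exponents given doubled). -/
def locMoment (M : EPoly) : ℚ :=
  (M.map fun t =>
    let a : ℕ := t.2.1 / 2
    let b : ℕ := t.2.2.1 / 2
    let c : ℕ := t.2.2.2 / 2
    t.1 * (dfOdd a * dfOdd b * dfOdd c) / ((8 : ℚ) ^ (a + b + c) * 8)).sum

/-- The Riesz–Gaussian moment of the product of two even Hermite symbols divided by `√π`: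
for symbol terms `d ∏_{j ∈ e/2} (−4π²ξⱼ²)` and `d' ∏ (−4π²ξⱼ²)`,
`∫ (…)(…) e^{-π²|ξ|²} |ξ|⁻² dξ = d d' (−4)^n (2a−1)!!(2b−1)!!(2c−1)!! · 2/((2n+1)2^n) · √π`, `(a,b,c) = (e+e')/2`, `n = a+b+c`. -/
def rieszPair (A B : List (ℚ × ℕ × ℕ × ℕ)) : ℚ :=
  (A.flatMap fun s => B.map fun t =>
    let a : ℕ := (s.2.1 + t.2.1) / 2
    let b : ℕ := (s.2.2.1 + t.2.2.1) / 2
    let c : ℕ := (s.2.2.2 + t.2.2.2) / 2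
    let n : ℕ := a + b + c
    s.1 * t.1 * (-4 : ℚ) ^ n * (dfOdd a * dfOdd b * dfOdd c) * (2 / ((2 * (n : ℚ) + 1) * (2 : ℚ) ^ n))).sum

end EPoly

/-! ### The pipeline -/

/-- An explicit polynomial field: the three component lists. -/
abbrev EField := Fin 3 → EPoly

/-- The polynomial of the jet `∂^l (P_a e^{-|x|²}) = (ejet P (a, l)) e^{-|x|²}`. -/
def ejet (P : EField) (w : JVar) : EPoly := EPoly.dgList 1 w.2 (P w.1)

/-- The product of the jet polynomials of a list of variables (normalised). -/
def eprodJets (P : EField) (ws : List JVar) : EPoly :=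
  ws.foldr (fun w acc => EPoly.norm (EPoly.mul (ejet P w) acc)) [(1, 0, 0, 0)]

/-- The Euler–Lagrange field of a jet polynomial `p` along `v = pgv 1 P`: component `a` of
`E_p = Σ_{terms c·w₁w₂w₃} Σ_s [w_s = (a, l)] (−1)^{|l|} c · ∂̃^{l} (∏_{j ≠ s} jet_j)` at Gaussian rate 2 (normalised). -/
def eEP (p : JPoly ℤ) (P : EField) (a : Fin 3) : EPoly :=
  p.foldr (fun t acc =>
    (List.finRange t.2.length).foldr (fun s acc' =>
      let w := t.2.get s
      if w.1 = a then
        EPoly.norm (EPoly.smul ((-1 : ℚ) ^ w.2.length * (t.1 : ℚ)) (EPoly.dgList 2 w.2 (eprodJets P (t.2.eraseIdx s))) ++ acc')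
      else acc') acc) []

/-- `W = 2 (v·∇) v` as polynomials (rate 2): the tree's `WP` on lists. -/
def eWP (P : EField) (i : Fin 3) : EPoly :=
  EPoly.smul 2 ((List.finRange 3).flatMap fun j => EPoly.mul (P j) (EPoly.dg 1 j (P i)))

/-- Divergence polynomial of a rate-`k` polynomial-Gaussian field: `Σᵢ dg k i (V i)`. -/
def ediv (k : ℕ) (V : Fin 3 → EPoly) : EPoly := EPoly.dg k 0 (V 0) ++ (EPoly.dg k 1 (V 1) ++ EPoly.dg k 2 (V 2))

/-- The local product `Σᵢ Wᵢ Qᵢ` (normalised). -/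
def eLoc (P : EField) (Q : Fin 3 → EPoly) : EPoly :=
  EPoly.norm ((List.finRange 3).flatMap fun i => EPoly.mul (eWP P i) (Q i))

/-- The evaluation in one pass: success-and-parity flag and value. The flag says: the field is divergence free, both
Hermite expansions (of `div W` and of `div G`) terminate with zero remainder and are even, and the local product
`Σᵢ Wᵢ (E_p)ᵢ` is even; the value is `½ (local Gaussian moment − Riesz moment / 32)`, so that
`Q_p(pgv 1 P) = value · π√π` when the flag is `true` (soundness theorem of the evaluator, proved elsewhere). -/
def evalRes (fuel : ℕ) (p : JPoly ℤ) (P : EField) : Bool × ℚ :=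
  let E := eEP p P
  let hW := EPoly.hermExp fuel (ediv 2 (eWP P))
  let hG := EPoly.hermExp fuel (ediv 2 E)
  let L := eLoc P E
  ((EPoly.norm (ediv 1 P)).isEmpty && hW.2.isEmpty && hG.2.isEmpty && EPoly.allEven hW.1 && EPoly.allEven hG.1 &&
      EPoly.allEven L,
    2⁻¹ * (EPoly.locMoment L - EPoly.rieszPair hW.1 hG.1 / 32))

/-- Hermite data of `div W` (the `LW` list of `pairing_value`, before conversion). -/
def eHermW (fuel : ℕ) (P : EField) : List (ℚ × ℕ × ℕ × ℕ) := (EPoly.hermExp fuel (ediv 2 (eWP P))).1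

/-- Hermite data of `div G`, `G = E_p e^{-2|x|²}` (the `LG` list of `pairing_value`, before conversion). -/
def eHermG (fuel : ℕ) (p : JPoly ℤ) (P : EField) : List (ℚ × ℕ × ℕ × ℕ) := (EPoly.hermExp fuel (ediv 2 (eEP p P))).1

/-! ### Conversions to the data format of `pairing_value` -/

/-- Halved multiplicities as a direction list: `pairs (halfList e) = dirList e` for even `e`. -/
def halfList (e : ℕ × ℕ × ℕ) : List (Fin 3) :=
  List.replicate (e.1 / 2) 0 ++ (List.replicate (e.2.1 / 2) 1 ++ List.replicate (e.2.2 / 2) 2)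

/-- Hermite data as a real `hermVal` list. -/
noncomputable def toLW (L : List (ℚ × ℕ × ℕ × ℕ)) : List (ℝ × List (Fin 3)) := L.map fun t => ((t.1 : ℝ), halfList t.2)

/-- An even polynomial as a real `polyE` list (exponents halved). -/
noncomputable def toMloc (M : EPoly) : List (ℝ × ℕ × ℕ × ℕ) :=
  M.map fun t => ((t.1 : ℝ), t.2.1 / 2, t.2.2.1 / 2, t.2.2.2 / 2)

/-- The product of two even Hermite symbols as a real `polyE` list. -/
noncomputable def toMfour (A B : List (ℚ × ℕ × ℕ × ℕ)) : List (ℝ × ℕ × ℕ × ℕ) :=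
  A.flatMap fun s => B.map fun t =>
    let n := (EPoly.tdeg s.2 + EPoly.tdeg t.2) / 2
    (((s.1 * t.1 * (-4 : ℚ) ^ n : ℚ) : ℝ) * Real.pi ^ (2 * n),
      (s.2.1 + t.2.1) / 2, (s.2.2.1 + t.2.2.1) / 2, (s.2.2.2 + t.2.2.2) / 2)

/-- The field of `P3` polynomials of an explicit field. -/
noncomputable def toP3v (P : EField) : Fin 3 → P3 := fun i => EPoly.toP3 (P i)

end Summit.NavierStokesRegularity.NavierStokesRegularity.Theorems.OddMorawetz
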